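import Literature.NumberTheory.EllipticCurves.AlgebraicModularParametrizationWithShift
import HarnessLib

/-!
# The `ℚ`-structure of `J₀(L)` on the analytic torus, with the Galois compatibility of EVERY lattice-compatible
# rational form: the hypothesis structure `ModularJacobianGaloisDataWithForms L ι` and its existence fact

Topic `Literature/NumberTheory/EllipticCurves`. Extension of the carrier `ModularJacobianGaloisData L ι` of
`AlgebraicModularParametrizationWithShift.lean` (the action of `Γ_ℚ` on `J₀(L)(ℂ)_tors = (V/Λ)_tors`, `𝕋_ℤ`-linear,
continuous, making every modular parametrisation `ModularParametrizationData.jacobiMap D : [φ] ↦ u_W(c·φ(f))` of LEVEL `L`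
`Γ_ℚ`-equivariant on torsion) by ONE further axiom, in the same «structure + separate existence fact» pattern:

* `ModularParametrizationData.jacobiMapForm D L g hg : J0 L →+ W(ℂ)`, `[φ] ↦ u_W(c·φ(g))` — a REAL definition with proved
  API (`jacobiMapForm_mk`, `jacobiMapForm_self`), for a parametrisation datum `D` of `W` at ANY level `N` (it supplies the
  uniformisation `u_W = D.uniformize`, the Néron lattice `Λ_E = D.L.lattice` and the Manin constant `c = D.c`) and a cusp
  form `g ∈ S₂(Γ₀(L))` at ANOTHER level `L` with `c·Λ_L(g) ⊆ Λ_E` (`hg`; `Λ_L(g) = {φ(g) : φ ∈ H₁(X₀(L);ℤ)}`) — e.g. `g`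
  the `D_S`-multiple of the `S`-depleted oldform of `f` at a level `L` with `N·∏_{ℓ∈S}ℓ² ∣ L`
  (`DepletedForm.mul_mem_periodLattice_of_mem_periodLattice_depleted`, Atkin–Lehner): the analytic homomorphism
  `J₀(L)(ℂ) = V_L/Λ_L → ℂ/Λ_E = W(ℂ)` induced by `φ ↦ c·φ(g)`;
* `ModularJacobianGaloisDataWithForms L ι` EXTENDS `ModularJacobianGaloisData L ι` by the field `jacobiMapForm_galAct`: for
  every such `(W, D, g)` with `g` having RATIONAL `q`-expansion at `∞`, `jacobiMapForm D L g hg` is `Γ_ℚ`-equivariant on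
  torsion (through `WeierstrassCurve.geomPointsToComplex W ι`);
* the named fact `nonempty_modularJacobianGaloisDataWithForms` (existence for every `L ≥ 1`, every `ι`), statement only.

WHY THE AXIOM IS PRINT (same words as clause (3) of `nonempty_algebraicModularParametrizationWithShift` /
`nonempty_modularJacobianGaloisData`). `φ_g : J₀(L)_ℂ → W_ℂ`, `[φ] ↦ u_W(c·φ(g))`, is an analytic, hence algebraic, homomorphism
of abelian varieties (Silverman AEC VI.4.1(b), VI.5.3 for the elliptic factor; GAGA), defined over `ℚ̄` (both varieties are;
rigidity); its pull-back of the `ℚ`-rational invariant differential `ω_W` of the model `W` is `c·ω_g`, `ω_g = 2πi g(τ)dτ` the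
differential on `X₀(L)` with the `q`-expansion of `g` at the `ℚ`-rational cusp `∞` — a `ℚ`-RATIONAL differential when that
`q`-expansion is rational (`q`-expansion principle, Darmon–Diamond–Taylor 1995 §1.5 p. 38: `S₂(Γ₀(L), ℚ)` = forms with rational
`q`-expansion; Diamond–Shurman §7.5 / Thm. 6.6.6 and §6.5 for Jacobians and differentials over `ℚ`); for `σ ∈ Γ_ℚ`,
`(σφ_g)^*ω_W = σ(φ_g^*ω_W) = σ(c·ω_g) = c·ω_g = φ_g^*ω_W`, so `σφ_g − φ_g` kills `ω_W` and is therefore zero (a homomorphism to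
an elliptic curve killing the invariant differential is constant in characteristic `0`, Silverman AEC II.4.2(c), III.5):
`φ_g` is defined over `ℚ`, i.e. `Γ_ℚ`-equivariant on `ℚ̄`-points (Shimura 1971 Thm. 7.14 and DDT §1.7 for the newform case).

CONSUMER. Crux C1 `stmt-BirchSwinnertonDyer-22296` (`MainConjectureTransportAlignedAtTwo`, cell bsd-f1-sign2, route
AlignedTransportAtTwo), line `birth`, residual (R1) at UNEQUAL conductors (plan `Cruxes/…/Lines/birth-deltapos-galois-plan.md`
(G4); lead att-p1 g10 typing ask T2, att-p4 g13 memo `DELTA-POS-ENGINE-att-p4-g13.md` §3(b) «T1⁺: slim carrier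
`(g ∈ S₂(Γ₀(N'), ℚ), c', c'Λ_g ⊆ Λ_W)`»): the Summits theorem
`…Theorems.AlignedTransportAtTwoDeltaPosJacobianLevel.half_transport_of_abstract` takes exactly the two clauses `galAct` /
`jacobiMapForm_galAct` of this structure as hypotheses.

What is NOT here: degeneracy maps `J₀(L) → J₀(N)` and their Galois compatibility (ask T2 proper); any statement that a depleted
form has rational coefficients or satisfies `hg` (consumer-side, Atkin–Lehner); BSD. TYPER LINT: no `instance`, no notation.

## References

* [DarmonDiamondTaylor1995] H. Darmon, F. Diamond, R. Taylor, *Fermat's Last Theorem*, §1.3 Thm. 1.15 (p. 28), §1.5 (pp. 34–38: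
  models over `ℚ`, Hecke correspondences over `ℚ`, the `q`-expansion principle), §1.7 Def. 1.44, Lemma 1.46 (pp. 44–45).
* [ShimuraIATAF1971] G. Shimura, *Introduction to the Arithmetic Theory of Automorphic Functions*, §6.7, Prop. 7.7, Thm. 7.9, Thm. 7.14.
* [DiamondShurman2005] F. Diamond, J. Shurman, *A First Course in Modular Forms*, §6.5–§6.6 (Jacobians and differentials over `ℚ`),
  §7.5 (rational structure via `q`-expansions).
* [SilvermanAEC2009] J. H. Silverman, *The Arithmetic of Elliptic Curves*, II.4.2(c), III.5, VI.4.1(b), VI.5.3.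
* [AtkinLehner1970] A. O. L. Atkin, J. Lehner, *Hecke operators on `Γ₀(m)`*, §3 (oldforms `g(τ) = f(dτ)`).
* [CremonaAlgorithms1997] J. E. Cremona, *Algorithms for Modular Elliptic Curves*, §2.10 (`φ(τ) = ℘`-image of `c·2πi∫f`).
-/

noncomputable section

open scoped ModularForm

open CongruenceSubgroup Complex

namespace Literature.NumberTheory.EllipticCurves.ModularForms

/-! ### §1. The Jacobi map of a lattice-compatible form at another level -/

section JacobiMapForm

variable {W : WeierstrassCurve ℚ} {N : ℕ} [NeZero N]

namespace ModularParametrizationData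

variable (D : ModularParametrizationData W N) (L : ℕ) (g : CuspForm (Gamma0 L) 2)

/-- The additive functional «evaluate at the form `g ∈ S₂(Γ₀(L))` and multiply by the Manin constant of `D`»,
`φ ↦ c·φ(g)` on `V_L = S₂(Γ₀(L))^∨` (the lift to `V_L` of the analytic map `J₀(L)(ℂ) → ℂ/Λ_E` induced by `g`; compare
`evalHom` = the case `L = N`, `g = f`). [cite: DarmonDiamondTaylor1995, §1.7 Lemma 1.46 (p. 45)] -/
def evalForm : Module.Dual ℂ (CuspForm (Gamma0 L) 2) →+ ℂ where
  toFun φ := (D.c : ℂ) * φ g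
  map_zero' := by simp
  map_add' φ ψ := by simp [mul_add]

/-- Unfolding `evalForm`. [cite: DarmonDiamondTaylor1995, §1.7 Lemma 1.46 (p. 45)] -/
@[simp] theorem evalForm_apply (φ : Module.Dual ℂ (CuspForm (Gamma0 L) 2)) :
    D.evalForm L g φ = (D.c : ℂ) * φ g :=
  rfl

variable [NeZero L]

/-- **The Jacobi map of a lattice-compatible form** `g ∈ S₂(Γ₀(L))` for a parametrisation datum `D` of `W` (any level `N`):
`J₀(L)(ℂ) = V_L/Λ_L → W(ℂ)`, `[φ] ↦ u_W(c·φ(g))`, well defined because `c·φ(g) ∈ Λ_E` for `φ ∈ Λ_L = H₁(X₀(L);ℤ)` (hypothesis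
`hg`) and `ker u_W = Λ_E`. For `L = N`, `g = f` this is `jacobiMap D` (`jacobiMapForm_self`); for `g = D_S·(S-depleted oldform of f)`
at `L` with `N·D_S ∣ L` the hypothesis `hg` is Atkin–Lehner (`DepletedForm.mul_mem_periodLattice_of_mem_periodLattice_depleted`).
[cite: DarmonDiamondTaylor1995, §1.7 Def. 1.44 and Lemma 1.46 (p. 44–45)] [cite: CremonaAlgorithms1997, §2.10] -/
def jacobiMapForm (hg : ∀ φ ∈ periodHomology L, (D.c : ℂ) * φ g ∈ D.L.lattice) :
    J0 L →+ (W.baseChange ℂ).toAffine.Point :=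
  QuotientAddGroup.lift (periodHomologyHecke L).toAddSubgroup (D.uniformize.comp (D.evalForm L g))
    fun φ hφ ↦ by
      rw [AddMonoidHom.mem_ker, AddMonoidHom.comp_apply, D.uniformize_eq_zero_iff]
      exact hg φ hφ

/-- `jacobiMapForm` on a representative: `jacobiMapForm [φ] = u_W(c·φ(g))`. [cite: CremonaAlgorithms1997, §2.10] -/
@[simp] theorem jacobiMapForm_mk (hg : ∀ φ ∈ periodHomology L, (D.c : ℂ) * φ g ∈ D.L.lattice)
    (φ : Module.Dual ℂ (CuspForm (Gamma0 L) 2)) :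
    D.jacobiMapForm L g hg (Submodule.Quotient.mk φ) = D.uniformize ((D.c : ℂ) * φ g) :=
  rfl

/-- At its own level and newform, `jacobiMapForm` IS `jacobiMap`: `jacobiMapForm D N D.f _ = jacobiMap D`.
[cite: DarmonDiamondTaylor1995, §1.7 Def. 1.44 and Lemma 1.46 (p. 44–45)] -/
theorem jacobiMapForm_self :
    D.jacobiMapForm N D.f (fun _ hφ ↦ D.evalHom_mem_lattice hφ) = D.jacobiMap := by
  refine AddMonoidHom.ext fun x ↦ ?_
  obtain ⟨φ, rfl⟩ := Submodule.Quotient.mk_surjective (periodHomologyHecke N) x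
  rw [jacobiMapForm_mk, jacobiMap_mk]

end ModularParametrizationData

end JacobiMapForm

/-! ### §2. The hypothesis structure with forms, and its existence fact -/

section GaloisData

variable (L : ℕ) [NeZero L] (ι : AlgebraicClosure ℚ →+* ℂ)

/-- **The `ℚ`-structure of `J₀(L)` on the analytic torus, with the Galois compatibility of every lattice-compatible RATIONAL form**
(hypothesis structure extending `ModularJacobianGaloisData L ι`). The extra AXIOM `jacobiMapForm_galAct`: for every Weierstrass model
`W/ℚ`, every parametrisation datum `D` of `W` (any level), every `g ∈ S₂(Γ₀(L))` with RATIONAL `q`-expansion at `∞` and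
`c·Λ_L(g) ⊆ Λ_E`, the Jacobi map `jacobiMapForm D L g : J₀(L)(ℂ) → W(ℂ)` is `Γ_ℚ`-equivariant on torsion points through `ι` — it is the
analytification of a `ℚ`-homomorphism `J₀(L) → W` (its pull-back of `ω_W` is the `ℚ`-rational differential `c·ω_g`; `q`-expansion
principle; a homomorphism to an elliptic curve killing `ω_W` is zero). Existence: `nonempty_modularJacobianGaloisDataWithForms`. No
uniqueness is claimed. [cite: DarmonDiamondTaylor1995, §1.5 (p. 34–38) and §1.7 Def. 1.44, Lemma 1.46 (p. 44–45)]
[cite: ShimuraIATAF1971, Thm. 7.14] -/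
structure ModularJacobianGaloisDataWithForms extends ModularJacobianGaloisData L ι where
  /-- For every `W/ℚ`, datum `D`, and rational lattice-compatible `g ∈ S₂(Γ₀(L))`, the Jacobi map of `g` is `Γ_ℚ`-equivariant
  on torsion points (through `ι`): `jacobiMapForm (σ x) = σ (jacobiMapForm x)`. -/
  jacobiMapForm_galAct : ∀ (W : WeierstrassCurve ℚ) (N : ℕ) [NeZero N] (D : ModularParametrizationData W N)
    (g : CuspForm (Gamma0 L) 2) (_ : ∀ n : ℕ, ∃ q : ℚ, cuspCoeff g n = (q : ℂ))
    (hg : ∀ φ ∈ periodHomology L, (D.c : ℂ) * φ g ∈ D.L.lattice)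
    (σ : Field.absoluteGaloisGroup ℚ) (x : J0.tors L) (P : W.geomPoints),
    D.jacobiMapForm L g hg (x : J0 L) = W.geomPointsToComplex ι P →
      D.jacobiMapForm L g hg ((galAct σ x : J0.tors L) : J0 L) = W.geomPointsToComplex ι (σ • P)

/-- **Existence of the `ℚ`-structure of `J₀(L)` with forms, every level** (named fact, statement only). For every `L ≥ 1` and every
embedding `ι : ℚ̄ →+* ℂ` there are data `ModularJacobianGaloisDataWithForms L ι`. Provenance: clauses (1)–(3) exactly as in
`nonempty_modularJacobianGaloisData` (Shimura's canonical `ℚ`-model of `X₀(L)`, its Jacobian over `ℚ` with `J₀(L)(ℂ) = V/Λ` by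
Abel–Jacobi, torsion points algebraic, Hecke correspondences over `ℚ`, `J₀(L)[n]` finite étale); clause (4) `jacobiMapForm_galAct`:
`φ_g : [φ] ↦ u_W(c·φ(g))` is an analytic hence algebraic homomorphism `J₀(L)_ℂ → W_ℂ`, defined over `ℚ̄`; `φ_g^*ω_W = c·ω_g` with
`ω_g = 2πi g(τ)dτ` `ℚ`-rational by the `q`-expansion principle (DDT §1.5 p. 38) since `g` has rational `q`-expansion at the
`ℚ`-rational cusp `∞`; hence `(σφ_g − φ_g)^*ω_W = 0` for `σ ∈ Γ_ℚ`, so `σφ_g = φ_g` (Silverman AEC II.4.2(c), III.5: a homomorphism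
to an elliptic curve with zero pull-back of the invariant differential is zero in characteristic `0`) — `φ_g` is defined over `ℚ`,
i.e. `Γ_ℚ`-equivariant on `ℚ̄`-points, transported to `(V/Λ)_tors` along `ι`. Not proved here (no `X₀(L)` over `ℚ` in the tree).
[cite: DarmonDiamondTaylor1995, §1.3 Thm. 1.15 (p. 28), §1.5 (p. 34–38), §1.7 Def. 1.44 and Lemma 1.46 (p. 44–45)]
[cite: ShimuraIATAF1971, §6.7, Prop. 7.7, Thm. 7.9, Thm. 7.14] [cite: SilvermanAEC2009, II.4.2(c), III.5, VI.4.1(b), VI.5.3] -/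
def nonempty_modularJacobianGaloisDataWithForms : Prop :=
  ∀ (L : ℕ) [NeZero L] (ι : AlgebraicClosure ℚ →+* ℂ), Nonempty (ModularJacobianGaloisDataWithForms L ι)

end GaloisData

end Literature.NumberTheory.EllipticCurves.ModularForms

end
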